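import Summits.RiemannHypothesis.RiemannHypothesis.Theses.SignCone
import Literature.NumberTheory.LFunctions.WeilCriterionProofs
import Literature.NumberTheory.LFunctions.WeilArchimedeanPositivityHolds
import Literature.NumberTheory.LFunctions.WeilWindowSimpleEven
import Summits.RiemannHypothesis.RiemannHypothesis.Theorems.SignConeSignConeDualityStubFarNode

/-!
# `SignCone.SignConeDuality` (crux stmt-RiemannHypothesis-16304): tightness — the crux is an
# equivalence at each cutoff; kill propagation to the target and to RH
# (negative-side support, cdisprove cycle 1)

Support file of the crux disprover (seat `refuter-cdisprove-stmt-RiemannHypothesis-16304-0`);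
companion of the crux workfile `Cruxes/SignConeDuality/Disproof.lean` (§B5 there). No definitions;
`Hyp a` = the unit-slack sign-cone inequality at cutoff `a` (VERBATIM the hypothesis of
`SignConeDuality` at `a` = body of the route target `SignConeInequality` at `a`), `Dual a` /
`DualWith a c` = VERBATIM its conclusion (resp. its matrix at a given weight `c`), all inline.

* `signConeDuality_hyp_of_dualWith` — **CONVERSE OF THE CRUX, for every weight**: if SOME `c ≥ 0`
  (no `c 1 = 0`, no support or summability condition) has unit slack on single tests at cutoff
  `a`, then `Hyp a`. Proof: sum the single-test inequalities over the family (`archPolar_sum`: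
  the prime-free form is additive on test kernels, tree `weilMellin_add` / `weilArchIntegral_add`),
  `Re (g⋆g̃)(0) = ∫‖g‖²` (tree `weilConv_weilReflect_apply_zero`), and drop the summed fake prime
  term, which is `≥ 0` on a node-nonnegative family sum: for EVERY `c` it is a finite sum over
  `n < ⌈e^{2a}⌉` (`autocorr_far_node_eq_zero`: `(g⋆g̃)(±log n) = 0` once `log n ≥ 2a`), hermitian
  symmetry gives `Re F(-log n) = Re F(log n)`, and the nodes `n = 0, 1` read `Re F(0) ≥ 0`.
  Hence `signConeDuality_converse : Dual a → Hyp a` — with the crux, `Hyp a ↔ Dual a` at every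
  cutoff: the hypothesis of `SignConeDuality` is EXACTLY as strong as its conclusion (tight: no
  weaker hypothesis can give `Dual a`, no stronger conclusion follows from `Hyp a` alone), and the
  unit constants `-Re F(0)` / `-∫‖g‖²` and the weight `n^{-1/2}` are forced to match.
* `signConeDuality_hyp_of_le_log_two_half` — the TARGET inequality at cutoffs `a ≤ (log 2)/2` is an
  unconditional theorem (Yoshida, tree `weilPositivityOn_log_two_half_holds`, through the converse
  at `c = Λ`).
* `signConeDuality_hyp_of_riemannHypothesis` — `RH → ∀ a, Hyp a`; KILL PROPAGATION
  `not_riemannHypothesis_of_not_signConeInequality`: a refutation of the route target (equivalently,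
  by the converse, of `Dual a` at any cutoff: `not_riemannHypothesis_of_not_dual`) is a disproof of
  RH — so neither side of the crux is refutable here short of `¬RH`, which is why this seat attacks
  hypotheses rather than truth.
-/

noncomputable section

open scoped BigOperators ArithmeticFunction.vonMangoldt ComplexConjugate ContDiff
open MeasureTheory Set Literature.NumberTheory.LFunctions

namespace Summit.RiemannHypothesis.RiemannHypothesis.Theorems.SignConeDuality.Negative

/-! ## Bookkeeping on test kernels -/

/-- Finite sums of Weil tests are Weil tests. [folklore] -/
theorem isWeilTest_sum {ι : Type*} (s : Finset ι) (G : ι → ℝ → ℂ) (hG : ∀ i, IsWeilTest (G i)) :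
    IsWeilTest (∑ i ∈ s, G i) := by
  classical
  refine Finset.induction_on s ?_ ?_
  · rw [Finset.sum_empty]
    exact ⟨contDiff_const, HasCompactSupport.zero⟩
  · intro a s ha ih
    rw [Finset.sum_insert ha]
    exact (hG a).add ih

/-- The prime-free Weil form vanishes at the zero kernel. [folklore] -/
theorem archPolar_zero : weilPolarTerm (0 : ℝ → ℂ) + weilArchTerm 0 = 0 := by
  simp [weilPolarTerm, weilArchTerm, weilArchIntegral, weilMellin]

/-- Additivity of the prime-free Weil form `W_ar = weilPolarTerm + weilArchTerm` over finite
families of test kernels (tree: `weilMellin_add`, `weilArchIntegral_add`). [folklore] -/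
theorem archPolar_sum {ι : Type*} (s : Finset ι) (G : ι → ℝ → ℂ) (hG : ∀ i, IsWeilTest (G i)) :
    weilPolarTerm (∑ i ∈ s, G i) + weilArchTerm (∑ i ∈ s, G i) =
      ∑ i ∈ s, (weilPolarTerm (G i) + weilArchTerm (G i)) := by
  classical
  refine Finset.induction_on s ?_ ?_
  · simpa using archPolar_zero
  · intro a s ha ih
    rw [Finset.sum_insert ha, Finset.sum_insert ha, ← ih]
    have hS := isWeilTest_sum s G hG
    simp only [weilPolarTerm, weilArchTerm, weilArchIntegral_add (hG a) hS,
      weilMellin_add (hG a).1.continuous (hG a).2 hS.1.continuous hS.2, Pi.add_apply]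
    ring

/-- The autocorrelation `g ⋆ g̃` of a continuous `g` supported in `[-a, a]` vanishes at every
`|t| ≥ 2a` (boundary included: `g` itself vanishes at `±a`; two-sided form of the landed `stub_farNode`, via its
`farNode_mem_Ioo_of_apply_ne_zero`). [folklore] -/
theorem autocorr_eq_zero_of_le_abs {a : ℝ} {g : ℝ → ℂ} (hg : Continuous g)
    (hsupp : tsupport g ⊆ Icc (-a) a) {t : ℝ} (ht : 2 * a ≤ |t|) :
    weilConv g (weilReflect g) t = 0 := by
  rw [weilConv_apply]
  have hzero : (fun u => g u * weilReflect g (t - u)) = fun _ => 0 := by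
    funext u
    simp only [weilReflect, neg_sub]
    by_cases hu : g u = 0
    · simp [hu]
    · have hu' := farNode_mem_Ioo_of_apply_ne_zero hg hsupp hu
      have hut : g (u - t) = 0 := by
        by_contra h
        have h' := farNode_mem_Ioo_of_apply_ne_zero hg hsupp h
        have : |t| < 2 * a := by
          rw [abs_lt]
          constructor <;> linarith [hu'.1, hu'.2, h'.1, h'.2]
        linarith
      simp [hut]
  rw [hzero, integral_zero]

/-- Far nodes are invisible at cutoff `a`: for `n ≥ ⌈e^{2a}⌉` both `(g⋆g̃)(log n)` and
`(g⋆g̃)(-log n)` vanish. [folklore] -/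
theorem autocorr_far_node_eq_zero {a : ℝ} {g : ℝ → ℂ} (hg : Continuous g)
    (hsupp : tsupport g ⊆ Icc (-a) a) {n : ℕ} (hn : ⌈Real.exp (2 * a)⌉₊ ≤ n) :
    weilConv g (weilReflect g) (Real.log n) = 0 ∧ weilConv g (weilReflect g) (-Real.log n) = 0 := by
  have hn' : Real.exp (2 * a) ≤ n := (Nat.le_ceil _).trans (by exact_mod_cast hn)
  have hpos : (0 : ℝ) < n := (Real.exp_pos _).trans_le hn'
  have hlog : 2 * a ≤ Real.log n := by
    rw [Real.le_log_iff_exp_le hpos]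
    exact hn'
  have h2a : 2 * a ≤ |Real.log n| := hlog.trans (le_abs_self _)
  exact ⟨autocorr_eq_zero_of_le_abs hg hsupp h2a,
    autocorr_eq_zero_of_le_abs hg hsupp (by rwa [abs_neg])⟩

/-- For EVERY weight `c` the fake prime term of an autocorrelation at cutoff `a` is a finite sum
over `n < ⌈e^{2a}⌉` (no summability hypothesis on `c` is ever needed). [folklore] -/
theorem fakePrime_eq_sum {a : ℝ} (c : ℕ → ℝ) {g : ℝ → ℂ} (hg : Continuous g)
    (hsupp : tsupport g ⊆ Icc (-a) a) :
    (∑' n : ℕ, ((c n : ℝ) : ℂ) / (Real.sqrt n : ℂ) * (weilConv g (weilReflect g) (Real.log n) + weilConv g (weilReflect g) (-Real.log n))) =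
      ∑ n ∈ Finset.range ⌈Real.exp (2 * a)⌉₊, ((c n : ℝ) : ℂ) / (Real.sqrt n : ℂ) *
        (weilConv g (weilReflect g) (Real.log n) + weilConv g (weilReflect g) (-Real.log n)) := by
  refine tsum_eq_sum fun n hn => ?_
  rw [Finset.mem_range, not_lt] at hn
  obtain ⟨h1, h2⟩ := autocorr_far_node_eq_zero hg hsupp hn
  simp [h1, h2]

/-- Core of the converse: over a finite family of tests supported in `[-a, a]`, summing the
single-test unit-slack inequalities for a weight `c ≥ 0` and dropping the summed fake prime term
(nonnegative as soon as the family sum is node-nonnegative) yields the sign-cone inequality for the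
family sum. [folklore] -/
theorem signCone_sum_ineq {ι : Type*} (s : Finset ι) {a : ℝ} {c : ℕ → ℝ} (hc : ∀ n, 0 ≤ c n)
    (g : ι → ℝ → ℂ) (hg : ∀ i, IsWeilTest (g i)) (hsupp : ∀ i, tsupport (g i) ⊆ Icc (-a) a)
    (hD : ∀ i, -(∫ t, ‖g i t‖ ^ 2) ≤ (weilPolarTerm (weilConv (g i) (weilReflect (g i))) +
      weilArchTerm (weilConv (g i) (weilReflect (g i))) -
        (∑' n : ℕ, ((c n : ℝ) : ℂ) / (Real.sqrt n : ℂ) * (weilConv (g i) (weilReflect (g i)) (Real.log n) + weilConv (g i) (weilReflect (g i)) (-Real.log n)))).re)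
    (hn : ∀ n : ℕ, 2 ≤ n → 0 ≤ ((∑ i ∈ s, weilConv (g i) (weilReflect (g i))) (Real.log n)).re) :
    -((∑ i ∈ s, weilConv (g i) (weilReflect (g i))) 0).re ≤
      (weilPolarTerm (∑ i ∈ s, weilConv (g i) (weilReflect (g i))) +
        weilArchTerm (∑ i ∈ s, weilConv (g i) (weilReflect (g i)))).re := by
  set K : ι → ℝ → ℂ := fun i => weilConv (g i) (weilReflect (g i)) with hK
  have hKW : ∀ i, IsWeilTest (K i) := fun i => (hg i).weilConv (hg i).weilReflect
  have hF0 : ((∑ i ∈ s, K i) 0).re = ∑ i ∈ s, ∫ t, ‖g i t‖ ^ 2 := by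
    rw [Finset.sum_apply, Complex.re_sum]
    refine Finset.sum_congr rfl fun i _ => ?_
    simp only [hK, weilConv_weilReflect_apply_zero, Complex.ofReal_re]
  have hF0' : 0 ≤ ((∑ i ∈ s, K i) 0).re := by
    rw [hF0]
    exact Finset.sum_nonneg fun i _ => integral_nonneg fun _ => by positivity
  have hW := archPolar_sum s K hKW
  set N := ⌈Real.exp (2 * a)⌉₊ with hN
  have hP : ∀ i, (∑' n : ℕ, ((c n : ℝ) : ℂ) / (Real.sqrt n : ℂ) * (K i (Real.log n) + K i (-Real.log n))) =
      ∑ n ∈ Finset.range N, ((c n : ℝ) : ℂ) / (Real.sqrt n : ℂ) *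
        (K i (Real.log n) + K i (-Real.log n)) :=
    fun i => fakePrime_eq_sum c (hg i).1.continuous (hsupp i)
  have hsymm : ∀ t : ℝ, ((∑ i ∈ s, K i) (-t)).re = ((∑ i ∈ s, K i) t).re := by
    intro t
    rw [Finset.sum_apply, Finset.sum_apply, Complex.re_sum, Complex.re_sum]
    refine Finset.sum_congr rfl fun i _ => ?_
    simp only [hK]
    rw [← conj_weilConv_weilReflect_neg (g i) t, Complex.conj_re]
  have hnode : ∀ n : ℕ, 0 ≤ ((∑ i ∈ s, K i) (Real.log n)).re := by
    intro n
    rcases Nat.lt_or_ge n 2 with hlt | hge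
    · interval_cases n <;> simpa using hF0'
    · exact hn n hge
  have hPsum : 0 ≤ (∑ i ∈ s, (∑' n : ℕ, ((c n : ℝ) : ℂ) / (Real.sqrt n : ℂ) * (K i (Real.log n) + K i (-Real.log n)))).re := by
    simp_rw [hP]
    rw [Finset.sum_comm, Complex.re_sum]
    refine Finset.sum_nonneg fun n _ => ?_
    rw [← Finset.mul_sum, Finset.sum_add_distrib]
    have h1 : ∑ i ∈ s, K i (Real.log n) = (∑ i ∈ s, K i) (Real.log n) := by
      rw [Finset.sum_apply]
    have h2 : ∑ i ∈ s, K i (-Real.log n) = (∑ i ∈ s, K i) (-Real.log n) := by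
      rw [Finset.sum_apply]
    rw [h1, h2]
    have hcoef : ((c n : ℝ) : ℂ) / (Real.sqrt n : ℂ) = ((c n / Real.sqrt n : ℝ) : ℂ) := by
      push_cast
      ring
    rw [hcoef, Complex.re_ofReal_mul, Complex.add_re, hsymm]
    refine mul_nonneg (div_nonneg (hc n) (Real.sqrt_nonneg _)) ?_
    linarith [hnode n]
  have hsum : ∑ i ∈ s, (-(∫ t, ‖g i t‖ ^ 2)) ≤
      ∑ i ∈ s, (weilPolarTerm (K i) + weilArchTerm (K i) - (∑' n : ℕ, ((c n : ℝ) : ℂ) / (Real.sqrt n : ℂ) * (K i (Real.log n) + K i (-Real.log n)))).re :=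
    Finset.sum_le_sum fun i _ => hD i
  have hsplit : ∑ i ∈ s, (weilPolarTerm (K i) + weilArchTerm (K i) - (∑' n : ℕ, ((c n : ℝ) : ℂ) / (Real.sqrt n : ℂ) * (K i (Real.log n) + K i (-Real.log n)))).re =
      (∑ i ∈ s, (weilPolarTerm (K i) + weilArchTerm (K i))).re -
        (∑ i ∈ s, (∑' n : ℕ, ((c n : ℝ) : ℂ) / (Real.sqrt n : ℂ) * (K i (Real.log n) + K i (-Real.log n)))).re := by
    rw [Complex.re_sum, Complex.re_sum, ← Finset.sum_sub_distrib]
    refine Finset.sum_congr rfl fun i _ => ?_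
    rw [Complex.sub_re]
  rw [hF0, hW]
  rw [Finset.sum_neg_distrib] at hsum
  linarith

/-! ## The converse of the crux and its consequences -/

/-- **Converse of `SignConeDuality`, for every weight.** If some `c ≥ 0` has unit slack on every
single test supported in `[-a, a]` (`DualWith a c`, verbatim the matrix of the crux's conclusion;
neither `c 1 = 0` nor any support/summability condition on `c` is needed), then the unit-slack
sign-cone inequality `Hyp a` (verbatim the crux's hypothesis) holds at cutoff `a`. [folklore] -/
theorem signConeDuality_hyp_of_dualWith :
    ∀ (a : ℝ) (c : ℕ → ℝ), (∀ n, 0 ≤ c n) →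
      (∀ g : ℝ → ℂ, (ContDiff ℝ ((⊤ : ℕ∞) : WithTop ℕ∞) g ∧ HasCompactSupport g) → tsupport g ⊆ Set.Icc (-a) a → let G : ℝ → ℂ := MeasureTheory.convolution g (fun u => (starRingEnd ℂ) (g (-u))) (ContinuousLinearMap.mul ℂ ℂ) MeasureTheory.MeasureSpace.volume; let M : ℂ → ℂ := fun s => ∫ u : ℝ, G u * Complex.exp ((s - 1 / 2) * u); -(∫ t, ‖g t‖ ^ 2) ≤ (M 0 + M 1 + ((1 / (2 * Real.pi) : ℂ) * (∫ t : ℝ, M (1 / 2 + t * Complex.I) * ((Complex.digamma (1 / 4 + t / 2 * Complex.I)).re : ℂ)) - G 0 * (Real.log Real.pi : ℂ)) - ∑' n : ℕ, ((c n : ℝ) : ℂ) / (Real.sqrt n : ℂ) * (G (Real.log n) + G (-Real.log n))).re) →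
      ∀ (k : ℕ) (g : Fin k → ℝ → ℂ), (∀ i, (ContDiff ℝ ((⊤ : ℕ∞) : WithTop ℕ∞) (g i) ∧ HasCompactSupport (g i)) ∧ tsupport (g i) ⊆ Set.Icc (-a) a) → let F : ℝ → ℂ := fun t => ∑ i, MeasureTheory.convolution (g i) (fun u => (starRingEnd ℂ) ((g i) (-u))) (ContinuousLinearMap.mul ℂ ℂ) MeasureTheory.MeasureSpace.volume t; (∀ n : ℕ, 2 ≤ n → 0 ≤ (F (Real.log n)).re) → let M : ℂ → ℂ := fun s => ∫ u : ℝ, F u * Complex.exp ((s - 1 / 2) * u); -(F 0).re ≤ (M 0 + M 1 + ((1 / (2 * Real.pi) : ℂ) * (∫ t : ℝ, M (1 / 2 + t * Complex.I) * ((Complex.digamma (1 / 4 + t / 2 * Complex.I)).re : ℂ)) - F 0 * (Real.log Real.pi : ℂ))).re := by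
  intro a c hc hD k g hg F hn M
  have hgW : ∀ i, IsWeilTest (g i) := fun i => (hg i).1
  have hF : F = ∑ i, weilConv (g i) (weilReflect (g i)) := by
    funext t
    show (∑ i, weilConv (g i) (weilReflect (g i)) t) = (∑ i, weilConv (g i) (weilReflect (g i))) t
    rw [Finset.sum_apply]
  have hDi : ∀ i, -(∫ t, ‖g i t‖ ^ 2) ≤ (weilPolarTerm (weilConv (g i) (weilReflect (g i))) +
      weilArchTerm (weilConv (g i) (weilReflect (g i))) -
        (∑' n : ℕ, ((c n : ℝ) : ℂ) / (Real.sqrt n : ℂ) * (weilConv (g i) (weilReflect (g i)) (Real.log n) + weilConv (g i) (weilReflect (g i)) (-Real.log n)))).re :=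
    fun i => hD (g i) (hg i).1 (hg i).2
  have hn' : ∀ n : ℕ, 2 ≤ n →
      0 ≤ ((∑ i, weilConv (g i) (weilReflect (g i))) (Real.log n)).re := by
    intro n h2
    have := hn n h2
    rwa [hF] at this
  show -(F 0).re ≤ (weilPolarTerm F + weilArchTerm F).re
  rw [hF]
  exact signCone_sum_ineq Finset.univ hc g hgW (fun i => (hg i).2) hDi hn'

/-- **The crux is an equivalence at each cutoff**: `Dual a → Hyp a` (conclusion and hypothesis of
`SignConeDuality` at `a`, verbatim). [folklore] -/
theorem signConeDuality_converse :
    ∀ a : ℝ, (∃ c : ℕ → ℝ, (∀ n, 0 ≤ c n) ∧ c 1 = 0 ∧ ∀ g : ℝ → ℂ, (ContDiff ℝ ((⊤ : ℕ∞) : WithTop ℕ∞) g ∧ HasCompactSupport g) → tsupport g ⊆ Set.Icc (-a) a → let G : ℝ → ℂ := MeasureTheory.convolution g (fun u => (starRingEnd ℂ) (g (-u))) (ContinuousLinearMap.mul ℂ ℂ) MeasureTheory.MeasureSpace.volume; let M : ℂ → ℂ := fun s => ∫ u : ℝ, G u * Complex.exp ((s - 1 / 2) * u); -(∫ t, ‖g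 t‖ ^ 2) ≤ (M 0 + M 1 + ((1 / (2 * Real.pi) : ℂ) * (∫ t : ℝ, M (1 / 2 + t * Complex.I) * ((Complex.digamma (1 / 4 + t / 2 * Complex.I)).re : ℂ)) - G 0 * (Real.log Real.pi : ℂ)) - ∑' n : ℕ, ((c n : ℝ) : ℂ) / (Real.sqrt n : ℂ) * (G (Real.log n) + G (-Real.log n))).re) →
      ∀ (k : ℕ) (g : Fin k → ℝ → ℂ), (∀ i, (ContDiff ℝ ((⊤ : ℕ∞) : WithTop ℕ∞) (g i) ∧ HasCompactSupport (g i)) ∧ tsupport (g i) ⊆ Set.Icc (-a) a) → let F : ℝ → ℂ := fun t => ∑ i, MeasureTheory.convolution (g i) (fun u => (starRingEnd ℂ) ((g i) (-u))) (ContinuousLinearMap.mul ℂ ℂ) MeasureTheory.MeasureSpace.volume t; (∀ n : ℕ, 2 ≤ n → 0 ≤ (F (Real.log n)).re) → let M : ℂ → ℂ := fun s => ∫ u : ℝ, F u * Complex.exp ((s - 1 / 2) * u); -(F 0).re ≤ (M 0 + M 1 + ((1 / (2 * Real.pi) : ℂ) * (∫ t : ℝ, M (1 / 2 + t * Complex.I)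 * ((Complex.digamma (1 / 4 + t / 2 * Complex.I)).re : ℂ)) - F 0 * (Real.log Real.pi : ℂ))).re :=
  fun a ⟨c, hc, _, hD⟩ => signConeDuality_hyp_of_dualWith a c hc hD

/-- Weil positivity on `[-a, a]` gives `Hyp a` (through the converse at the true weight `c = Λ`:
at `c = Λ` the item's fake Weil form IS the tree's `weilQuadratic`, definitionally). [folklore] -/
theorem signConeDuality_hyp_of_weilPositivityOn :
    ∀ a : ℝ, WeilPositivityOn a →
      ∀ (k : ℕ) (g : Fin k → ℝ → ℂ), (∀ i, (ContDiff ℝ ((⊤ : ℕ∞) : WithTop ℕ∞) (g i) ∧ HasCompactSupport (g i)) ∧ tsupport (g i) ⊆ Set.Icc (-a) a) → let F : ℝ → ℂ := fun t => ∑ i, MeasureTheory.convolution (g i) (fun u => (starRingEnd ℂ) ((g i) (-u))) (ContinuousLinearMap.mul ℂ ℂ) MeasureTheory.MeasureSpace.volume t; (∀ n : ℕ, 2 ≤ n → 0 ≤ (F (Real.log n)).re) → let M : ℂ → ℂ := fun s => ∫ u : ℝ, F u * Complex.exp ((s - 1 / 2) * u); -(F 0).re ≤ (M 0 + M 1 +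 ((1 / (2 * Real.pi) : ℂ) * (∫ t : ℝ, M (1 / 2 + t * Complex.I) * ((Complex.digamma (1 / 4 + t / 2 * Complex.I)).re : ℂ)) - F 0 * (Real.log Real.pi : ℂ))).re := by
  intro a h
  refine signConeDuality_hyp_of_dualWith a (fun n => Λ n)
    (fun _ => ArithmeticFunction.vonMangoldt_nonneg) ?_
  intro g hg hsupp
  have hW : 0 ≤ (weilQuadratic g).re := h g hg hsupp
  have hN : 0 ≤ ∫ t : ℝ, ‖g t‖ ^ 2 := integral_nonneg fun _ => by positivity
  show -(∫ t : ℝ, ‖g t‖ ^ 2) ≤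
    (weilPolarTerm (weilConv g (weilReflect g)) + weilArchTerm (weilConv g (weilReflect g)) -
      weilPrimeTerm (weilConv g (weilReflect g))).re
  have hQ : weilPolarTerm (weilConv g (weilReflect g)) + weilArchTerm (weilConv g (weilReflect g)) -
      weilPrimeTerm (weilConv g (weilReflect g)) = weilQuadratic g := by
    simp only [weilQuadratic, weilFunctional]
    ring
  rw [hQ]
  linarith

/-- **The route TARGET at small cutoffs is a theorem.** For `a ≤ (log 2)/2` the unit-slack
sign-cone inequality `Hyp a` holds unconditionally (Yoshida 1992 Thm 1, tree
`weilPositivityOn_log_two_half_holds`). [folklore] -/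
theorem signConeDuality_hyp_of_le_log_two_half :
    ∀ a : ℝ, a ≤ Real.log 2 / 2 →
      ∀ (k : ℕ) (g : Fin k → ℝ → ℂ), (∀ i, (ContDiff ℝ ((⊤ : ℕ∞) : WithTop ℕ∞) (g i) ∧ HasCompactSupport (g i)) ∧ tsupport (g i) ⊆ Set.Icc (-a) a) → let F : ℝ → ℂ := fun t => ∑ i, MeasureTheory.convolution (g i) (fun u => (starRingEnd ℂ) ((g i) (-u))) (ContinuousLinearMap.mul ℂ ℂ) MeasureTheory.MeasureSpace.volume t; (∀ n : ℕ, 2 ≤ n → 0 ≤ (F (Real.log n)).re) → let M : ℂ → ℂ := fun s => ∫ u : ℝ, F u * Complex.exp ((s - 1 / 2) * u); -(F 0).re ≤ (M 0 + M 1 + ((1 / (2 * Real.pi) : ℂ) * (∫ t : ℝ, M (1 / 2 + t * Complex.I) * ((Complex.digamma (1 / 4 + t / 2 * Complex.I)).re : ℂ)) - F 0 * (Real.log Real.pi : ℂ))).re :=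
  fun a ha => signConeDuality_hyp_of_weilPositivityOn a fun g hg hsupp =>
    weilPositivityOn_log_two_half_holds g hg (hsupp.trans (Icc_subset_Icc (by linarith) ha))

/-- `RH → Hyp a` at every cutoff (Weil's criterion, tree `weil_criterion_holds`, through the
converse at `c = Λ`). [folklore] -/
theorem signConeDuality_hyp_of_riemannHypothesis :
    Summit.RiemannHypothesis → ∀ a : ℝ,
      ∀ (k : ℕ) (g : Fin k → ℝ → ℂ), (∀ i, (ContDiff ℝ ((⊤ : ℕ∞) : WithTop ℕ∞) (g i) ∧ HasCompactSupport (g i)) ∧ tsupport (g i) ⊆ Set.Icc (-a) a) → let F : ℝ → ℂ := fun t => ∑ i, MeasureTheory.convolution (g i) (fun u => (starRingEnd ℂ) ((g i) (-u))) (ContinuousLinearMap.mul ℂ ℂ) MeasureTheory.MeasureSpace.volume t; (∀ n : ℕ, 2 ≤ n → 0 ≤ (F (Real.log n)).re) → let M : ℂ → ℂ := fun s => ∫ u : ℝ, F u * Complex.exp ((s - 1 / 2) * u); -(F 0).re ≤ (M 0 + M 1 + ((1 / (2 * Real.pi) : ℂ) * (∫ t : ℝ, M (1 / 2 + t * Complex.I)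 * ((Complex.digamma (1 / 4 + t / 2 * Complex.I)).re : ℂ)) - F 0 * (Real.log Real.pi : ℂ))).re :=
  fun hRH a => signConeDuality_hyp_of_weilPositivityOn a fun g hg _ => weil_criterion_holds.1 hRH g hg

/-- **Kill propagation (target).** A refutation of the route target `SignConeInequality` would be
a disproof of the Riemann hypothesis. [folklore] -/
theorem not_riemannHypothesis_of_not_signConeInequality
    (h : ¬ Theses.SignCone.SignConeInequality) : ¬ Summit.RiemannHypothesis :=
  fun hRH => h fun a _ => signConeDuality_hyp_of_riemannHypothesis hRH a

/-- **Kill propagation (conclusion of the crux).** A cutoff `a` at which NO nonnegative weight has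
unit slack (`¬ Dual a`) would be a disproof of the Riemann hypothesis (`c = Λ` works under RH).
[folklore] -/
theorem not_riemannHypothesis_of_not_dual :
    ∀ a : ℝ, ¬ (∃ c : ℕ → ℝ, (∀ n, 0 ≤ c n) ∧ c 1 = 0 ∧ ∀ g : ℝ → ℂ, (ContDiff ℝ ((⊤ : ℕ∞) : WithTop ℕ∞) g ∧ HasCompactSupport g) → tsupport g ⊆ Set.Icc (-a) a → let G : ℝ → ℂ := MeasureTheory.convolution g (fun u => (starRingEnd ℂ) (g (-u))) (ContinuousLinearMap.mul ℂ ℂ) MeasureTheory.MeasureSpace.volume; let M : ℂ → ℂ := fun s => ∫ u : ℝ, G u * Complex.exp ((s - 1 / 2) * u); -(∫ t, ‖g t‖ ^ 2) ≤ (M 0 + M 1 + ((1 / (2 * Real.pi) : ℂ) * (∫ t : ℝ, M (1 / 2 + t * Complex.I) * ((Complex.digamma (1 / 4 + t / 2 * Complex.I)).re : ℂ)) - G 0 * (Real.log Real.pi : ℂ)) - ∑' n : ℕ, ((c n : ℝ) : ℂ) / (Real.sqrt n : ℂ) * (G (Real.log n) + G (-Real.log n))).re) → ¬ Summit.RiemannHypothesis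 := by
  intro a h hRH
  refine h ⟨fun n => Λ n, fun _ => ArithmeticFunction.vonMangoldt_nonneg,
    by simp [ArithmeticFunction.vonMangoldt_apply_one], ?_⟩
  intro g hg _
  have hW : 0 ≤ (weilQuadratic g).re := weil_criterion_holds.1 hRH g hg
  have hN : 0 ≤ ∫ t : ℝ, ‖g t‖ ^ 2 := integral_nonneg fun _ => by positivity
  show -(∫ t : ℝ, ‖g t‖ ^ 2) ≤
    (weilPolarTerm (weilConv g (weilReflect g)) + weilArchTerm (weilConv g (weilReflect g)) -
      weilPrimeTerm (weilConv g (weilReflect g))).re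
  have hQ : weilPolarTerm (weilConv g (weilReflect g)) + weilArchTerm (weilConv g (weilReflect g)) -
      weilPrimeTerm (weilConv g (weilReflect g)) = weilQuadratic g := by
    simp only [weilQuadratic, weilFunctional]
    ring
  rw [hQ]
  linarith

end Summit.RiemannHypothesis.RiemannHypothesis.Theorems.SignConeDuality.Negative

end
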